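import Summits.ValiantsHypothesis.ValiantsHypothesis.Theorems.DivisionGapPerDivisionHardCellContent
import Summits.ValiantsHypothesis.ValiantsHypothesis.Theorems.DivisionGapPerDivisionHardStubTorusCellSplit
import Summits.ValiantsHypothesis.ValiantsHypothesis.Theorems.DivisionGapPerDivisionHardStubMatrixCellSplit
import Summits.ValiantsHypothesis.ValiantsHypothesis.Theorems.DivisionGapPerDivisionHardStubCellContentSubexpRigid

/-!
# Crux `DivisionGap.PerDivisionHard` (stmt-ValiantsHypothesis-5065) — the cell-content rung, EXTENDED: split sums and
oblivious branching programs in ANY variable order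

Continuation of `Theorems/DivisionGapPerDivisionHardCellContent.lean` (the crux inequality for every cofactor of
quasi-polynomial rank `|Φ_Y(supp h)|` across some balanced partition `(Y, Yᶜ)` of the matrix variables).  Two
unconditional corollaries, compositions of v14 of line `pair-descent-jss-endpoint` with every stub a landed theorem:

* `perDivisionHard_cellSplit` — **every `h = Σ_{t<W} f_t · g_t ≠ 0` with `W ≤ 2^{(log₂ n+c)^c}`, every `f_t` in the
  variables `x_e, e ∈ Y` and every `g_t` in the variables `x_e, e ∉ Y`, for a balanced cell set `Y`
  (`n² ≤ 4|Y| ≤ 3n²`), `f_t, g_t` otherwise ARBITRARY** — via the torus normal form within the class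
  (`stub_torusCellSplit`: `|Φ_Y(supp h')| ≤ W`);
* `perDivisionHard_oabp` — **every nonzero entry of a product `Ms₁.prod * Ms₂.prod` of `W × W` matrices of
  polynomials, `W ≤ 2^{(log₂ n+c)^c}`, the matrices of `Ms₁` in the variables of `Y` and those of `Ms₂` in the other
  variables** — a monotone oblivious algebraic branching program of width `W` reading the variables in ANY order whose
  first half (the set `Y` of variables read by `Ms₁`) is balanced; via `stub_matrixCellSplit`;
* `perDivisionHard_cellContentSubexp` — **the cell-content rung already at SUBEXPONENTIAL rank
  `|Φ_Y(supp h)| ≤ 2^{n/(log₂ n+e)^e}`** (`e = e(c)`; long subdivision paths, `stub_cellContentSubexpRigid`): an undecided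
  cofactor of the crux has rank `> 2^{n/polylog n}` across EVERY balanced partition of the variables.
-/

noncomputable section

-- `Summit.ValiantsHypothesis.ValiantsHypothesis.…` is the tree's mandated single-conjunct layout
-- (Sub = Summit), so the duplicated namespace component is intended.
set_option linter.dupNamespace false

namespace Summit.ValiantsHypothesis.ValiantsHypothesis.Theorems.DivisionGapPerDivisionHard

open MvPolynomial Literature.Computability.AlgebraicComplexity
open scoped NNReal

/-- **The cell-split rung of `PerDivisionHard`.**  For every `c` there is `n₀` such that for all `n ≥ n₀`, every
cell set `Y` with `n² ≤ 4|Y| ≤ 3n²`, every `W ≤ 2^{(log₂ n + c)^c}` and all families `f, g : Fin W → ℝ≥0[x_ij]` with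
every `f_t` in the variables of `Y` and every `g_t` in the variables outside `Y`: if `h = Σ_t f_t · g_t ≠ 0` then
`2^{(log₂ n + c)^c} < L(per_n · h) + L(h)` — whatever the degrees, supports and costs of the `f_t, g_t` (monotone
rank `≤ 2^B` across one balanced partition of the variables; `W = 1`: a cofactor factoring across a balanced
partition of the variables never helps).  The torus normal form within the class (`stub_torusCellSplit`) has at most
`W` distinct `Y`-contents; then `two_pow_lt_pair_of_cellContent`. [folklore] -/
theorem perDivisionHard_cellSplit :
    ∀ c : ℕ, ∃ n₀ : ℕ, ∀ n ≥ n₀, ∀ (W : ℕ) (Y : Finset (Fin n × Fin n))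
      (f g : Fin W → MvPolynomial (Fin n × Fin n) ℝ≥0),
      n * n ≤ 4 * Y.card → 4 * Y.card ≤ 3 * (n * n) → W ≤ 2 ^ ((Nat.log 2 n + c) ^ c) →
      ∑ t, f t * g t ≠ 0 →
      (∀ t, ∀ mm ∈ (f t).support, ∀ e ∈ mm.support, e ∈ Y) →
      (∀ t, ∀ mm ∈ (g t).support, ∀ e ∈ mm.support, e ∉ Y) →
      2 ^ ((Nat.log 2 n + c) ^ c) <
        complexity (perPoly (Fin n) ℝ≥0 * ∑ t, f t * g t) + complexity (∑ t, f t * g t) := by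
  intro c
  obtain ⟨n₀, hmain⟩ := two_pow_lt_pair_of_cellContent c
  refine ⟨n₀, fun n hn W Y f g hY₁ hY₂ hW hh hf hg => ?_⟩
  obtain ⟨h', hh', htor, hcardW, hle1, -⟩ := stub_torusCellSplit n W Y f g hh hf hg
  exact hmain n hn _ h' hh' htor hle1 Y hY₁ hY₂ (hcardW.trans hW)

/-- **The oblivious-branching-program rung of `PerDivisionHard`.**  For every `c` there is `n₀` such that for all
`n ≥ n₀`, every cell set `Y` with `n² ≤ 4|Y| ≤ 3n²`, every width `W ≤ 2^{(log₂ n+c)^c}` and all lists `Ms₁, Ms₂` of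
`W × W` matrices of polynomials, the matrices of `Ms₁` in the variables of `Y` and those of `Ms₂` in the variables
outside `Y` (a monotone oblivious ABP of width `W` in ANY variable order, split at a balanced point; any number of
layers, any degrees): every nonzero entry `h = (Ms₁.prod * Ms₂.prod) s₀ t₀` satisfies
`2^{(log₂ n+c)^c} < L(per_n·h) + L(h)`.  Such an entry is a cell-split sum (`stub_matrixCellSplit`). [folklore] -/
theorem perDivisionHard_oabp :
    ∀ c : ℕ, ∃ n₀ : ℕ, ∀ n ≥ n₀, ∀ (W : ℕ) (Y : Finset (Fin n × Fin n))
      (Ms₁ Ms₂ : List (Matrix (Fin W) (Fin W) (MvPolynomial (Fin n × Fin n) ℝ≥0))) (s₀ t₀ : Fin W),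
      n * n ≤ 4 * Y.card → 4 * Y.card ≤ 3 * (n * n) → W ≤ 2 ^ ((Nat.log 2 n + c) ^ c) →
      (∀ M ∈ Ms₁, ∀ a b, ∀ mm ∈ (M a b).support, ∀ e ∈ mm.support, e ∈ Y) →
      (∀ M ∈ Ms₂, ∀ a b, ∀ mm ∈ (M a b).support, ∀ e ∈ mm.support, e ∉ Y) →
      (Ms₁.prod * Ms₂.prod) s₀ t₀ ≠ 0 →
      2 ^ ((Nat.log 2 n + c) ^ c) <
        complexity (perPoly (Fin n) ℝ≥0 * (Ms₁.prod * Ms₂.prod) s₀ t₀) +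
          complexity ((Ms₁.prod * Ms₂.prod) s₀ t₀) := by
  intro c
  obtain ⟨n₀, hR⟩ := perDivisionHard_cellSplit c
  refine ⟨n₀, fun n hn W Y Ms₁ Ms₂ s₀ t₀ hY₁ hY₂ hW h₁ h₂ hh => ?_⟩
  obtain ⟨f, g, hfg, hf, hg⟩ := stub_matrixCellSplit n W Y Ms₁ Ms₂ s₀ t₀ h₁ h₂
  rw [hfg] at hh ⊢
  exact hR n hn W Y f g hY₁ hY₂ hW hh hf hg

/-- **Column mode at subexponential rank, pair interface.**  As `two_pow_lt_pair_of_cellContentCol` with the count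
`≤ 2^{n/(log₂ n+e)^e}` (`stub_cellContentSubexpRigid`). [folklore] -/
theorem two_pow_lt_pair_of_cellContentColSubexp (c : ℕ) :
    ∃ e n₀ : ℕ, ∀ n ≥ n₀, ∀ h h' : MvPolynomial (Fin n × Fin n) ℝ≥0, h' ≠ 0 → IsTorusHomogeneous h' →
      complexity (perPoly (Fin n) ℝ≥0 * h') ≤ complexity (perPoly (Fin n) ℝ≥0 * h) →
      ∀ Y : Finset (Fin n × Fin n),
      n ≤ 8 * (Finset.univ.filter fun cc : Fin n =>
          n / 64 < (Finset.univ.filter fun r : Fin n => (r, cc) ∈ Y).card ∧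
          n / 64 < (Finset.univ.filter fun r : Fin n => (r, cc) ∉ Y).card).card →
      (h'.support.image fun (mm : (Fin n × Fin n) →₀ ℕ) (cc : Fin n) =>
          ∑ r ∈ Finset.univ.filter (fun r : Fin n => (r, cc) ∈ Y), mm (r, cc)).card ≤ 2 ^ (n / (Nat.log 2 n + e) ^ e) →
      2 ^ ((Nat.log 2 n + c) ^ c) < complexity (perPoly (Fin n) ℝ≥0 * h) + complexity h := by
  obtain ⟨κ, hcon⟩ := stub_jssContraction
  obtain ⟨d, n₁, hhard⟩ := stub_blockArsenal c κ
  obtain ⟨e, n₀, hS⟩ := stub_cellContentSubexpRigid d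
  refine ⟨e, n₀ + n₁, ?_⟩
  intro n hn h h' hh' htor hle1 Y hlive hcard
  by_contra hlt
  have hle : complexity (perPoly (Fin n) ℝ≥0 * h) + complexity h ≤
      2 ^ ((Nat.log 2 n + c) ^ c) := not_lt.mp hlt
  obtain ⟨b, k, m, eR, eC, w, u, hb, hcut, hsingle⟩ := hS n (by omega) h' hh' htor Y hlive hcard
  have hdesc := stub_faceDescent n (placedBlock eR eC) w h' u hcut hh' hsingle
  have h1 : complexity (monomial u (1 : ℝ≥0) * facePer (placedBlock eR eC)) ≤
      2 ^ ((Nat.log 2 n + c) ^ c) + 1 :=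
    calc complexity (monomial u (1 : ℝ≥0) * facePer (placedBlock eR eC))
        ≤ complexity (perPoly (Fin n) ℝ≥0 * h') + 1 := hdesc
      _ ≤ complexity (perPoly (Fin n) ℝ≥0 * h) + 1 := Nat.add_le_add_right hle1 1
      _ ≤ 2 ^ ((Nat.log 2 n + c) ^ c) + 1 :=
          Nat.add_le_add_right (le_trans (Nat.le_add_right _ _) hle) 1
  have h2 : complexity (facePer (placedBlock eR eC)) ≤
      ((n + 2) * (2 ^ ((Nat.log 2 n + c) ^ c) + 3)) ^ κ :=
    calc complexity (facePer (placedBlock eR eC))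
        ≤ ((n + 2) * (complexity (monomial u (1 : ℝ≥0) * facePer (placedBlock eR eC)) + 2)) ^ κ :=
          hcon n (facePer (placedBlock eR eC)) u
      _ ≤ ((n + 2) * (2 ^ ((Nat.log 2 n + c) ^ c) + 3)) ^ κ :=
          Nat.pow_le_pow_left (Nat.mul_le_mul_left _ (by omega)) κ
  have h3 := hhard n (by omega) b k m eR eC hb
  exact absurd (lt_of_lt_of_le h3 h2) (lt_irrefl _)

/-- **Both modes at subexponential rank, pair interface** (mode selection `stub_heavyLines`, row mode by transposing
`h'`). [folklore] -/
theorem two_pow_lt_pair_of_cellContentSubexp (c : ℕ) :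
    ∃ e n₀ : ℕ, ∀ n ≥ n₀, ∀ h h' : MvPolynomial (Fin n × Fin n) ℝ≥0, h' ≠ 0 → IsTorusHomogeneous h' →
      complexity (perPoly (Fin n) ℝ≥0 * h') ≤ complexity (perPoly (Fin n) ℝ≥0 * h) →
      ∀ Y : Finset (Fin n × Fin n), n * n ≤ 4 * Y.card → 4 * Y.card ≤ 3 * (n * n) →
      (h'.support.image fun (mm : (Fin n × Fin n) →₀ ℕ) =>
          ((fun r : Fin n => ∑ cc ∈ Finset.univ.filter (fun cc : Fin n => (r, cc) ∈ Y), mm (r, cc)),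
           (fun cc : Fin n => ∑ r ∈ Finset.univ.filter (fun r : Fin n => (r, cc) ∈ Y), mm (r, cc)))).card ≤
        2 ^ (n / (Nat.log 2 n + e) ^ e) →
      2 ^ ((Nat.log 2 n + c) ^ c) < complexity (perPoly (Fin n) ℝ≥0 * h) + complexity h := by
  obtain ⟨e, n₀, hcol⟩ := two_pow_lt_pair_of_cellContentColSubexp c
  refine ⟨e, n₀ + 1, fun n hn h h' hh' htor hle1 Y hY₁ hY₂ hcard => ?_⟩
  classical
  have hn1 : 0 < n := by omega
  rcases stub_heavyLines n (n / 64) Y hY₁ hY₂ (Nat.mul_div_le n 64) hn1 with hC | hR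
  · refine hcol n (by omega) h h' hh' htor hle1 Y hC (le_trans ?_ hcard)
    rw [show (fun (mm : (Fin n × Fin n) →₀ ℕ) (cc : Fin n) =>
          ∑ r ∈ Finset.univ.filter (fun r : Fin n => (r, cc) ∈ Y), mm (r, cc)) =
        Prod.snd ∘ (fun (mm : (Fin n × Fin n) →₀ ℕ) =>
          ((fun r : Fin n => ∑ cc ∈ Finset.univ.filter (fun cc : Fin n => (r, cc) ∈ Y), mm (r, cc)),
           (fun cc : Fin n => ∑ r ∈ Finset.univ.filter (fun r : Fin n => (r, cc) ∈ Y), mm (r, cc)))) from rfl,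
      ← Finset.image_image]
    exact Finset.card_image_le
  · set sw : Fin n × Fin n → Fin n × Fin n := Prod.swap with hsw
    have hswinj : Function.Injective sw := Prod.swap_injective
    obtain ⟨hle1', -, hsupp⟩ := stub_transposePair n h'
    have hh'' : rename sw h' ≠ 0 := fun h0 => hh' (rename_injective sw hswinj (by rw [h0, map_zero]))
    have htor' : IsTorusHomogeneous (rename sw h') := isTorusHomogeneous_rename_swap htor
    set Y' : Finset (Fin n × Fin n) := Y.image sw with hY'
    have hmemY' : ∀ r cc : Fin n, (r, cc) ∈ Y' ↔ (cc, r) ∈ Y := by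
      intro r cc
      rw [hY', Finset.mem_image]
      constructor
      · rintro ⟨⟨a, b⟩, hab, he⟩
        simp only [hsw, Prod.swap_prod_mk, Prod.mk.injEq] at he
        obtain ⟨rfl, rfl⟩ := he
        exact hab
      · intro hmem
        exact ⟨(cc, r), hmem, rfl⟩
    have hlive' : n ≤ 8 * (Finset.univ.filter fun cc : Fin n =>
        n / 64 < (Finset.univ.filter fun r : Fin n => (r, cc) ∈ Y').card ∧
        n / 64 < (Finset.univ.filter fun r : Fin n => (r, cc) ∉ Y').card).card := by
      refine le_trans hR (le_of_eq ?_)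
      congr 2
      ext x
      simp only [Finset.mem_filter, Finset.mem_univ, true_and, hmemY']
    have hcard' : ((rename sw h').support.image fun (mm : (Fin n × Fin n) →₀ ℕ) (cc : Fin n) =>
        ∑ r ∈ Finset.univ.filter (fun r : Fin n => (r, cc) ∈ Y'), mm (r, cc)).card ≤
        2 ^ (n / (Nat.log 2 n + e) ^ e) := by
      rw [hsupp, Finset.image_image]
      refine le_trans ?_ hcard
      rw [show ((fun (mm : (Fin n × Fin n) →₀ ℕ) (cc : Fin n) =>
            ∑ r ∈ Finset.univ.filter (fun r : Fin n => (r, cc) ∈ Y'), mm (r, cc)) ∘ Finsupp.mapDomain sw) =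
          Prod.fst ∘ (fun (mm : (Fin n × Fin n) →₀ ℕ) =>
            ((fun r : Fin n => ∑ cc ∈ Finset.univ.filter (fun cc : Fin n => (r, cc) ∈ Y), mm (r, cc)),
             (fun cc : Fin n => ∑ r ∈ Finset.univ.filter (fun r : Fin n => (r, cc) ∈ Y), mm (r, cc)))) from ?_,
        ← Finset.image_image]
      · exact Finset.card_image_le
      · funext mm cc
        simp only [Function.comp_apply]
        refine Finset.sum_congr (by ext r; simp only [Finset.mem_filter, Finset.mem_univ, true_and, hmemY'])
          fun r _ => ?_
        change Finsupp.mapDomain sw mm (r, cc) = mm (cc, r)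
        rw [show ((r, cc) : Fin n × Fin n) = sw (cc, r) from rfl, Finsupp.mapDomain_apply hswinj]
    exact hcol n (by omega) h (rename sw h') hh'' htor' (hle1'.trans hle1) Y' hlive' hcard'

/-- **The cell-content rung at subexponential rank.**  For every `c` there are `e n₀` such that for all `n ≥ n₀`, every
nonzero `h` and every cell set `Y` with `n² ≤ 4|Y| ≤ 3n²`: if the monomials of `h` have at most `2^{n/(log₂ n+e)^e}`
distinct `Y`-contents `Φ_Y(m)`, then `2^{(log₂ n+c)^c} < L(per_n·h) + L(h)`. [folklore] -/
theorem perDivisionHard_cellContentSubexp :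
    ∀ c : ℕ, ∃ e n₀ : ℕ, ∀ n ≥ n₀, ∀ h : MvPolynomial (Fin n × Fin n) ℝ≥0, h ≠ 0 → ∀ Y : Finset (Fin n × Fin n),
      n * n ≤ 4 * Y.card → 4 * Y.card ≤ 3 * (n * n) →
      (h.support.image fun (mm : (Fin n × Fin n) →₀ ℕ) =>
          ((fun r : Fin n => ∑ cc ∈ Finset.univ.filter (fun cc : Fin n => (r, cc) ∈ Y), mm (r, cc)),
           (fun cc : Fin n => ∑ r ∈ Finset.univ.filter (fun r : Fin n => (r, cc) ∈ Y), mm (r, cc)))).card ≤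
        2 ^ (n / (Nat.log 2 n + e) ^ e) →
      2 ^ ((Nat.log 2 n + c) ^ c) < complexity (perPoly (Fin n) ℝ≥0 * h) + complexity h := by
  intro c
  obtain ⟨e, n₀, hmain⟩ := two_pow_lt_pair_of_cellContentSubexp c
  refine ⟨e, n₀, fun n hn h hh Y hY₁ hY₂ hcard => ?_⟩
  obtain ⟨h', hh', htor, hsupp, hle1, -⟩ := stub_torusSupport n h hh
  exact hmain n hn h h' hh' htor hle1 Y hY₁ hY₂
    (le_trans (Finset.card_le_card (Finset.image_subset_image hsupp)) hcard)

end Summit.ValiantsHypothesis.ValiantsHypothesis.Theorems.DivisionGapPerDivisionHard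

end
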